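/-
Copyright (c) 2026 the pub-hodgecm-mathlib formalisation cell (harness21).  Prover seat hodgecm-mathlib-F0P3a-p07 (g11): road «S3-tree» (LEAD F0P3a-plan (g11), architect
A-p16 (g29) rulings A-81 (1) ∕ A-87 (2) «SPAN-0-ram»; (F2) the ramified block (R) DISCHARGED), brick «SPAN-0-ram», the closing file; 2026-09-01.
-/
import Literature.NumberTheory.Rogawski1990.UnitaryVertexStabilizerSpanSelfDualRamifiedFrameCM   -- ★ p846344 (this seat) (c‴): `span_isSelfDual_of_neg_of_isUnit`, `span_isSelfDual_std_of_neg_of_isUnit` (block (R) as hypothesis)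
import Literature.NumberTheory.Automorphic.RamifiedPlaceAntiFixedUniformizer                    -- ★ `exists_uniformizer_galAdicCompletionMap_complexConj_eq_neg_of_ramified` (R1), ★ `valued_galAdicCompletionMap_sub_lt_one_of_ramified` (R2)
import Literature.NumberTheory.Automorphic.RamifiedPlaceIntegerInvolution                      -- ★ ramified place kit: `isUnit_two_integer_of_v_two_eq_one`; brings ★ `Kramer1981.henselianLocalRing_integer`, ★ bridge `ValuedFieldValuativeRelBridge`, ★ `IwahoriGL.residue_eq_zero_iff_valuation_lt_one`
import HarnessLib

/-!
# «SPAN-0-ram», CLOSED: at a TAMELY RAMIFIED non-split place of good reduction the pieces live on self-dual vertex stabilisers — hypotheses `e(w|v) ≠ 1` and `|2|_w = 1` only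
# (Bruhat–Tits 1972 §10; Rogawski 1990 §4.9; Serre, *Local Fields* II §4, V §3; Jacobowitz 1962 §8)

Topic `NumberTheory/Rogawski1990`; namespace `Literature.NumberTheory.Rogawski1990`.  THEOREMS ONLY (no definition, no instance, no notation, no named fact, no `sorry`); kernel
lane.  Cell `pub/hodgecm-mathlib` (D-0151), crux H413 = `stmt-HodgeConjecture-24833`; road «S3-tree», architect A-81 (1) ∕ A-87 (2): the RAMIFIED BLOCK (R) of ★
`span_isSelfDual_of_neg_of_isUnit` ∕ ★ `span_isSelfDual_std_of_neg_of_isUnit` (★ p846344) is PRODUCED at every tamely ramified non-split place `w ∣ v` of the CM extension `L ∕ L⁺`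
from `e(w|v) ≠ 1` and `|2|_w = 1`, using the tree's ramified place kit: (R1) the anti-fixed uniformiser ★ `exists_uniformizer_galAdicCompletionMap_complexConj_eq_neg_of_ramified`
(F0-era, A-p19 lineage); (R2) residual triviality of `σ_w` ★ `valued_galAdicCompletionMap_sub_lt_one_of_ramified` (`c` lies in the inertia group; Liu2021 Lem. D.1 kit); (R4) the
(norm) property WITH LEVEL — §1 here: in the Henselian `𝒪_w` (★ `Kramer1981.henselianLocalRing_integer`) with `2 ∈ 𝒪_w^×` and `σ` residually trivial, a `σ`-fixed principal unit
`u` is `s·σs` with `σs = s`, `s ≡ 1`, `(s−1)(s+1) = u−1`, `s+1 ∈ 𝒪_w^×` (Hensel on `X² − u` at `1`; uniqueness of the root near `1`), hence `|s − 1| = |u − 1|`.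
CONSEQUENCE (§3): **`span_isSelfDual_of_ramified` ∕ `span_isSelfDual_std_of_ramified`** = ★ `span_isSelfDual` ∕ ★ `span_isSelfDual_std` (F0P2-p06, unramified `v`) with the
hypothesis `(hv : IsUnramifiedIn)` REPLACED by `(he : e(w|v) ≠ 1) (h2 : |2|_w = 1)` and nothing else: «SPAN-0» holds over the whole TAME scope (T10-2 (B)).
HONEST LABEL: HC_CM is proved only modulo the 2 remaining named inputs (hLiu418 24832, h413 24833) until rung 0 closes; nothing printed is asserted here; S3 (`stub_N6nsS3id`)
stays a print row until the road's END lands; the dyadic places (`v ∣ 2`) remain outside (S3-wild).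

* §1 **`exists_mul_map_eq_of_map_eq_of_sub_one_mem_level`** (Henselian (norm) with level, abstract).
* §2 **`ramifiedBlock_adicCompletion`** (the block (R) at a tamely ramified non-split place: `ϖ`, `σ_w ϖ = −ϖ`, `hres`, `hnorm`).
* §3 **`span_isSelfDual_of_ramified`**, **`span_isSelfDual_std_of_ramified`**.

## References
* [BruhatTits1972] F. Bruhat, J. Tits, *Groupes réductifs sur un corps local I*, Publ. Math. IHÉS 41 (1972), §10.
* [Rogawski1990] J. D. Rogawski, *Automorphic Representations of Unitary Groups in Three Variables*, Ann. of Math. Stud. 123 (1990), §4.9 Lemma 4.9.3 p. 56.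
* [Serre1979] J.-P. Serre, *Local Fields*, GTM 67 (1979), Ch. II §4 Prop. 7 (Hensel), Ch. V §3 (tame ramification).
* [Jacobowitz1962] R. Jacobowitz, *Hermitian forms over local fields*, Amer. J. Math. 84 (1962), §8.
-/

set_option autoImplicit false

noncomputable section

open scoped WithZero Matrix MatrixGroups ValuativeRel
open Topology Set NumberField IsDedekindDomain Matrix ValuativeRel

/-! ## §1 Hensel: the (norm) property with level, abstract -/

namespace Literature.NumberTheory.Automorphic.UnitaryGroup

/-- **A `σ`-FIXED PRINCIPAL UNIT IS A NORM, WITH LEVEL** (Henselian local ring `R`, `2 ∈ R^×`, `σ` residually trivial): if `σu = u` and `u ≡ 1 (mod 𝔪)` then `u = s·σs` with `σs = s`,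
`s − 1 ∈ 𝔪`, `s + 1 ∈ R^×` and `(s − 1)(s + 1) = u − 1` — Hensel on `X² − u` at `1`, and the root near `1` is unique (`σs` is another one).  Level form of ★
`exists_mul_map_eq_of_map_eq_of_sub_one_mem`. [cite: Serre1979, Ch. II §4 Prop. 7] [cite: Jacobowitz1962, §8] -/
theorem exists_mul_map_eq_of_map_eq_of_sub_one_mem_level {R : Type*} [CommRing R] [HenselianLocalRing R] (τ : R →+* R) (h2 : IsUnit (2 : R))
    (hres : ∀ r : R, τ r - r ∈ IsLocalRing.maximalIdeal R) (u : R) (hτu : τ u = u) (hu : u - 1 ∈ IsLocalRing.maximalIdeal R) :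
    ∃ s : R, s * τ s = u ∧ τ s = s ∧ s - 1 ∈ IsLocalRing.maximalIdeal R ∧ IsUnit (s + 1) ∧ (s - 1) * (s + 1) = u - 1 := by
  -- Hensel on `X² − u` at `a₀ = 1`
  have h1 : Polynomial.eval 1 (Polynomial.X ^ 2 - Polynomial.C u) ∈ IsLocalRing.maximalIdeal R := by
    simp only [Polynomial.eval_sub, Polynomial.eval_pow, Polynomial.eval_X, Polynomial.eval_C, one_pow]
    have : (1 : R) - u = -(u - 1) := by ring
    rw [this]; exact (Ideal.neg_mem_iff _).2 hu
  have hd : IsUnit (Polynomial.eval 1 (Polynomial.derivative (Polynomial.X ^ 2 - Polynomial.C u))) := by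
    have : Polynomial.eval 1 (Polynomial.derivative (Polynomial.X ^ 2 - Polynomial.C u)) = 2 := by
      simp; norm_num
    rw [this]; exact h2
  obtain ⟨s, hs, hs1⟩ := HenselianLocalRing.is_henselian (Polynomial.X ^ 2 - Polynomial.C u) (Polynomial.monic_X_pow_sub_C u two_ne_zero) 1 h1 hd
  have hsq : s ^ 2 = u := by
    have h := hs
    simp only [Polynomial.IsRoot, Polynomial.eval_sub, Polynomial.eval_pow, Polynomial.eval_X, Polynomial.eval_C] at h
    exact sub_eq_zero.1 h
  -- units: `x ∈ R^×` iff `x ∉ 𝔪`; `2 ∉ 𝔪`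
  have h2m : (2 : R) ∉ IsLocalRing.maximalIdeal R := fun h => (IsLocalRing.mem_maximalIdeal _).1 h h2
  have hunit : ∀ {x : R}, x - 1 ∈ IsLocalRing.maximalIdeal R → IsUnit (x + 1) := by
    intro x hx
    by_contra hcon
    have hmem : x + 1 ∈ IsLocalRing.maximalIdeal R := (IsLocalRing.mem_maximalIdeal _).2 (mem_nonunits_iff.2 hcon)
    have : (2 : R) = (x + 1) - (x - 1) := by ring
    exact h2m (this ▸ Ideal.sub_mem _ hmem hx)
  -- `τ s` is the other root near `1`, hence equals `s`
  have hτs1 : τ s - 1 ∈ IsLocalRing.maximalIdeal R := by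
    have : τ s - 1 = (τ s - s) + (s - 1) := by ring
    rw [this]; exact Ideal.add_mem _ (hres s) hs1
  have hτsq : (τ s) ^ 2 = u := by rw [← map_pow, hsq, hτu]
  have hprod : (s + τ s) * (s - τ s) = 0 := by
    have : (s + τ s) * (s - τ s) = s ^ 2 - (τ s) ^ 2 := by ring
    rw [this, hsq, hτsq, sub_self]
  have hsum : IsUnit (s + τ s) := by
    by_contra hcon
    have hmem : s + τ s ∈ IsLocalRing.maximalIdeal R := (IsLocalRing.mem_maximalIdeal _).2 (mem_nonunits_iff.2 hcon)
    have hs1' : s + 1 ∈ IsLocalRing.maximalIdeal R := by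
      have : s + 1 = (s + τ s) - (τ s - 1) := by ring
      rw [this]; exact Ideal.sub_mem _ hmem hτs1
    exact (IsLocalRing.mem_maximalIdeal _).1 hs1' (hunit hs1)
  have hτs : τ s = s := by
    have h := (hsum.mul_right_eq_zero).1 hprod
    exact (sub_eq_zero.1 h).symm
  refine ⟨s, by rw [hτs, ← pow_two, hsq], hτs, hs1, hunit hs1, ?_⟩
  have : (s - 1) * (s + 1) = s ^ 2 - 1 := by ring
  rw [this, hsq]

end Literature.NumberTheory.Automorphic.UnitaryGroup

namespace Literature.NumberTheory.Rogawski1990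

open Literature.NumberTheory.Automorphic Literature.NumberTheory.Automorphic.UnitaryGroup Literature.NumberTheory.GaloisRepresentations
open Literature.NumberTheory.Automorphic.UnitaryLatticeTree Literature.NumberTheory.Automorphic.HermitianLattice
open Literature.NumberTheory.Automorphic.Liu2021.LemD1IndexedNonVacuityRamifiedConverse (valued_galAdicCompletionMap_sub_lt_one_of_ramified)

variable (L : Type) [Field L] [NumberField L] [IsCMField L] (H' : Matrix (Fin 3) (Fin 3) L) (v : HeightOneSpectrum (𝓞 ↥(maximalRealSubfield L)))
  (w : PlacesOver L v) (hw : IsCMField.complexConj L • w.1 = w.1)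

/-! ## §2 The ramified block (R) at a tamely ramified non-split place -/

/-- **THE RAMIFIED BLOCK (R) AT A TAMELY RAMIFIED NON-SPLIT PLACE** (`e(w|v) ≠ 1`, `|2|_w = 1`): a uniformiser `ϖ` of `L_w` with `σ_w ϖ = −ϖ` (★ (R1)), residual triviality
`|σ_w x − x|_w < 1` on `𝒪_w` (★ (R2)), and the (norm) property with level for `σ_w`-fixed principal units (§1 in the Henselian `𝒪_w`, ★ `Kramer1981.henselianLocalRing_integer`).
This is the producer of the hypotheses `(hϖ) (hσϖ) (hres) (hnorm)` of ★ `span_isSelfDual_of_neg_of_isUnit`. [cite: Serre1979, Ch. II §4 Prop. 7, Ch. V §3] [cite: Jacobowitz1962, §8] -/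
theorem ramifiedBlock_adicCompletion (he : v.asIdeal.ramificationIdx' w.1.asIdeal ≠ 1) (h2 : Valued.v (2 : w.1.adicCompletion L) = 1) :
    ∃ ϖ : w.1.adicCompletion L, Valued.v ϖ = WithZero.exp (-1 : ℤ) ∧ galAdicCompletionMap (L := L) (IsCMField.complexConj L) hw ϖ = -ϖ ∧
      (∀ x : w.1.adicCompletion L, Valued.v x ≤ 1 → Valued.v (galAdicCompletionMap (L := L) (IsCMField.complexConj L) hw x - x) < 1) ∧
      (∀ u : w.1.adicCompletion L, galAdicCompletionMap (L := L) (IsCMField.complexConj L) hw u = u → Valued.v (u - 1) < 1 →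
        ∃ z : w.1.adicCompletion L, z * galAdicCompletionMap (L := L) (IsCMField.complexConj L) hw z = u ∧ Valued.v (z - 1) ≤ Valued.v (u - 1)) := by
  classical
  set K := w.1.adicCompletion L
  set σ := galAdicCompletionMap (L := L) (IsCMField.complexConj L) hw with hσdef
  haveI : HenselianLocalRing 𝒪[K] := Literature.NumberTheory.EllipticCurves.Kramer1981.henselianLocalRing_integer
  have hres : ∀ x : K, Valued.v x ≤ 1 → Valued.v (σ x - x) < 1 := fun x hx =>
    valued_galAdicCompletionMap_sub_lt_one_of_ramified L (IsCMField.complexConj L) v (IsCMField.complexConj_ne_one L) w hw he x hx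
  obtain ⟨ϖu, hϖv, hϖσ⟩ := exists_uniformizer_galAdicCompletionMap_complexConj_eq_neg_of_ramified L w hw he h2
  refine ⟨(ϖu : K), hϖv, hϖσ, hres, fun u hσu hu1 => ?_⟩
  -- (norm) with level, in `𝒪[K]`
  have hσO : ∀ x : 𝒪[K], σ x ∈ 𝒪[K] := fun x => mem_integer_galAdicCompletionMap (IsCMField.complexConj L) v w hw x
  have hmem : ∀ x : 𝒪[K], x ∈ IsLocalRing.maximalIdeal 𝒪[K] ↔ Valued.v (x : K) < 1 := fun x => by
    rw [← IsLocalRing.residue_eq_zero_iff, residue_eq_zero_iff_valuation_lt_one, ← Valuation.vlt_one_iff (valuation K),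
      Valuation.vlt_one_iff (Valued.v : Valuation K (WithZero (Multiplicative ℤ)))]
  have hle : ∀ x : 𝒪[K], Valued.v (x : K) ≤ 1 := fun x => by
    rw [← Valuation.vle_one_iff (Valued.v : Valuation K (WithZero (Multiplicative ℤ))), Valuation.vle_one_iff (valuation K)]
    exact (Valuation.mem_integer_iff _ _).1 x.2
  set τ : 𝒪[K] →+* 𝒪[K] := (σ.comp (𝒪[K]).subtype).codRestrict (𝒪[K]) fun x => hσO x with hτdef
  have hresτ : ∀ r : 𝒪[K], τ r - r ∈ IsLocalRing.maximalIdeal 𝒪[K] := fun r => by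
    rw [hmem]; exact hres (r : K) (hle r)
  have h2O : IsUnit (2 : 𝒪[K]) := isUnit_two_integer_of_v_two_eq_one w.1 h2
  -- `u ∈ 𝒪[K]`, `u − 1 ∈ 𝔪`
  have hvu : Valued.v u ≤ 1 := by
    have : u = (u - 1) + 1 := by ring
    rw [this]
    exact Valuation.map_add_le _ hu1.le (by rw [map_one])
  have huO : u ∈ 𝒪[K] := (v_le_one_iff_mem_integer u).1 hvu
  set uO : 𝒪[K] := ⟨u, huO⟩ with huOdef
  have hτuO : τ uO = uO := Subtype.ext hσu
  have hu1O : uO - 1 ∈ IsLocalRing.maximalIdeal 𝒪[K] := by rw [hmem]; exact hu1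
  obtain ⟨s, hs, -, -, hunit, hlevel⟩ := exists_mul_map_eq_of_map_eq_of_sub_one_mem_level τ h2O hresτ uO hτuO hu1O
  refine ⟨(s : K), congrArg Subtype.val hs, ?_⟩
  -- the level: `(s − 1)(s + 1) = u − 1` with `|s + 1| = 1`
  have hv1 : Valued.v ((s : K) + 1) = 1 := by
    have h := Valuation.Integers.one_of_isUnit (Valuation.integer.integers (valuation K)) hunit
    change valuation K ((s : K) + 1) = 1 at h
    exact (v_eq_one_iff_valuation_eq_one _).2 h
  have hKlevel : ((s : K) - 1) * ((s : K) + 1) = u - 1 := by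
    have h := congrArg Subtype.val hlevel
    push_cast at h
    exact h
  have hveq : Valued.v ((s : K) - 1) = Valued.v (u - 1) := by
    rw [← hKlevel, map_mul, hv1, mul_one]
  exact hveq.le

/-! ## §3 «SPAN-0» at tamely ramified places, closed -/

section Span

variable [iM' : ∀ γ : (cmDatum L 3 H').Local v, MeasurableSpace ((cmDatum L 3 H').Local v ⧸ Subgroup.centralizer ({γ} : Set ((cmDatum L 3 H').Local v)))]
  [iB' : ∀ γ : (cmDatum L 3 H').Local v, BorelSpace ((cmDatum L 3 H').Local v ⧸ Subgroup.centralizer ({γ} : Set ((cmDatum L 3 H').Local v)))]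

/-- **«SPAN-0» AT A TAMELY RAMIFIED PLACE OF GOOD REDUCTION — hypotheses `e(w|v) ≠ 1`, `|2|_w = 1` only** (blocks (R), (F) both DISCHARGED): every `φ ∈ C_c^∞(U(H′)(L⁺_v))` has finitely many pieces `g k`,
each smooth, supported in a COMPACT OPEN stabiliser `K k` of a SELF-DUAL vertex lattice `latt g_k` and `Ad(K k)`-invariant, with `Σᶠ_c Δ(γH, out c)·Φ(c, φ) = Σ_k Σᶠ_c Δ·Φ(c, g k)`
for all `G`-regular `γH` near `1`** — ★ `span_of_cover` at `P := IsSelfDualLattice σ_w ϖ H′_w (latt ·)` over the §1 cover.  This is the END-contract stub «SPAN» with the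
self-dual `IsVertexStab` text of A-66 (1). [cite: Rogawski1990, §4.9 Lemma 4.9.3 p. 56] [cite: LanglandsShelstad1990Descent, §2.1] [cite: BruhatTits1972, §10] -/
theorem span_isSelfDual_of_ramified (hH' : (H'.map (cmConjRingHom L))ᵀ = H') (hdet' : H'.det ≠ 0)
    (he : v.asIdeal.ramificationIdx' w.1.asIdeal ≠ 1) (h2 : Valued.v (2 : w.1.adicCompletion L) = 1)
    (hH'w : IsUnit (placeForm H' w.1)) (hH'i : hH'w.unit ∈ glInt 3 (w.1.adicCompletion L))
    {ϖ : w.1.adicCompletion L} (hϖ : Valued.v ϖ = WithZero.exp (-1 : ℤ))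
    (T : LocalTransferFactor L H' v) {mG : OrbitalMeasureFamily ((cmDatum L 3 H').Local v)}
    (hmG : mG.IsAdmissibleOn fun γ' => IsRegularElt (γ'.val : GL (Fin 3) (LocalRing L v)))
    (φ : (cmDatum L 3 H').Local v → ℂ) (hφ : IsLocSmooth φ) :
    ∃ (n : ℕ) (K : Fin n → Subgroup ((cmDatum L 3 H').Local v)) (g : Fin n → (cmDatum L 3 H').Local v → ℂ),
      (∀ k, ∃ gk : GL (Fin 3) (w.1.adicCompletion L),
        IsSelfDualLattice (galAdicCompletionMap (L := L) (IsCMField.complexConj L) hw) ϖ (placeForm H' w.1) (latt (gk : Matrix (Fin 3) (Fin 3) (w.1.adicCompletion L))) ∧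
        IsCompact (K k : Set ((cmDatum L 3 H').Local v)) ∧ IsOpen (K k : Set ((cmDatum L 3 H').Local v)) ∧
        ∀ u : (cmDatum L 3 H').Local v, u ∈ K k ↔
          mapGL ((localNonsplitEquiv (IsCMField.complexConj L) H' (IsCMField.complexConj_ne_one L) w hw u :
              ↥(unitaryGroupOfForm (galAdicCompletionMap (L := L) (IsCMField.complexConj L) hw) (placeForm H' w.1))) :
            GL (Fin 3) (w.1.adicCompletion L)) (latt (gk : Matrix (Fin 3) (Fin 3) (w.1.adicCompletion L))) = latt (gk : Matrix (Fin 3) (Fin 3) (w.1.adicCompletion L))) ∧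
      (∀ k, IsLocSmooth (g k)) ∧ (∀ k, tsupport (g k) ⊆ (K k : Set ((cmDatum L 3 H').Local v))) ∧
      (∀ k, ∀ u ∈ K k, ∀ x, g k (u * x * u⁻¹) = g k x) ∧
      ∃ V ∈ 𝓝 (1 : (cmDatum L 2 (Matrix.of fun i j : Fin 2 => if i.val + j.val + 1 = 2 then (1 : L) else 0)).Local v ×
          (cmDatum L 1 (Matrix.of fun i j : Fin 1 => if i.val + j.val + 1 = 1 then (1 : L) else 0)).Local v),
        ∀ γH ∈ V, IsLocalGRegular L v γH →
          (∑ᶠ c : ConjClasses ((cmDatum L 3 H').Local v), T.Δ γH (Quotient.out c) * classOrbitalIntegral mG φ c) =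
            ∑ k, ∑ᶠ c : ConjClasses ((cmDatum L 3 H').Local v), T.Δ γH (Quotient.out c) * classOrbitalIntegral mG (g k) c := by
  obtain ⟨ϖ₀, hϖ₀, hσϖ₀, hres, hnorm⟩ := ramifiedBlock_adicCompletion L v w hw he h2
  obtain ⟨n, K, g, hK, hrest⟩ := span_isSelfDual_of_neg_of_isUnit L H' v w hw hH' hdet' hH'w hH'i hϖ₀ hσϖ₀ hres h2 hnorm T hmG φ hφ
  refine ⟨n, K, g, fun k => ?_, hrest⟩
  obtain ⟨gk, hsd, hKc, hKo, hKmem⟩ := hK k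
  exact ⟨gk, (isSelfDualLattice_congr_of_v_eq (by rw [hϖ₀, hϖ]) _ _).1 hsd, hKc, hKo, hKmem⟩

include hw in
/-- **«SPAN-0» RE-CENTRED AT `K_std` AT A TAMELY RAMIFIED PLACE OF GOOD REDUCTION — hypotheses `e(w|v) ≠ 1`, `|2|_w = 1` only** (blocks (R), (F) both DISCHARGED): every `φ ∈ C_c^∞(U(H′)(L⁺_v))` has finitely many pieces
`g k`, each smooth, supported in `K_std = cmLocalIntegralLevel L 3 H′ v` and `Ad(K_std)`-invariant, with `Σᶠ_c Δ(γH, out c)·Φ(c, φ) = Σ_k Σᶠ_c Δ·Φ(c, g k)` for all `G`-regular `γH`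
near `1` (★ `span_isSelfDual`, re-centred by §1's `x_k` with `K_k = x_k K_std x_k⁻¹`; orbital integrals by ★ `classOrbitalIntegral_comp_conj` on the regular = `Δ ≠ 0` classes).
This is the END-contract stub «SPAN» WITHOUT `IsVertexStab`. [cite: Rogawski1990, §4.9 Lemma 4.9.3 p. 56] [cite: LanglandsShelstad1990Descent, §2.1] [cite: BruhatTits1972, §10] -/
theorem span_isSelfDual_std_of_ramified (hH' : (H'.map (cmConjRingHom L))ᵀ = H') (hdet' : H'.det ≠ 0)
    (he : v.asIdeal.ramificationIdx' w.1.asIdeal ≠ 1) (h2 : Valued.v (2 : w.1.adicCompletion L) = 1)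
    (hH'w : IsUnit (placeForm H' w.1)) (hH'i : hH'w.unit ∈ glInt 3 (w.1.adicCompletion L))
    (T : LocalTransferFactor L H' v) {mG : OrbitalMeasureFamily ((cmDatum L 3 H').Local v)}
    (hmG : mG.IsAdmissibleOn fun γ' => IsRegularElt (γ'.val : GL (Fin 3) (LocalRing L v)))
    (φ : (cmDatum L 3 H').Local v → ℂ) (hφ : IsLocSmooth φ) :
    ∃ (n : ℕ) (g : Fin n → (cmDatum L 3 H').Local v → ℂ),
      (∀ k, IsLocSmooth (g k)) ∧ (∀ k, tsupport (g k) ⊆ (cmLocalIntegralLevel L 3 H' v : Set ((cmDatum L 3 H').Local v))) ∧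
      (∀ k, ∀ u ∈ cmLocalIntegralLevel L 3 H' v, ∀ x, g k (u * x * u⁻¹) = g k x) ∧
      ∃ V ∈ 𝓝 (1 : (cmDatum L 2 (Matrix.of fun i j : Fin 2 => if i.val + j.val + 1 = 2 then (1 : L) else 0)).Local v ×
          (cmDatum L 1 (Matrix.of fun i j : Fin 1 => if i.val + j.val + 1 = 1 then (1 : L) else 0)).Local v),
        ∀ γH ∈ V, IsLocalGRegular L v γH →
          (∑ᶠ c : ConjClasses ((cmDatum L 3 H').Local v), T.Δ γH (Quotient.out c) * classOrbitalIntegral mG φ c) =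
            ∑ k, ∑ᶠ c : ConjClasses ((cmDatum L 3 H').Local v), T.Δ γH (Quotient.out c) * classOrbitalIntegral mG (g k) c := by
  obtain ⟨ϖ₀, hϖ₀, hσϖ₀, hres, hnorm⟩ := ramifiedBlock_adicCompletion L v w hw he h2
  exact span_isSelfDual_std_of_neg_of_isUnit L H' v w hw hH' hdet' hH'w hH'i hϖ₀ hσϖ₀ hres h2 hnorm T hmG φ hφ

end Span

end Literature.NumberTheory.Rogawski1990

end
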